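import Mathlib
import HarnessLib
import Summits.NavierStokesRegularity.NavierStokesRegularity.Theorems.PoloidalWindowDoorLrcModEntireHorizontalPeriod

/-!
# Route `PoloidalWindowDoor`, item `LrcModEntire` (stmt-NavierStokesRegularity-20428), cell (Q4) of the (TH) column —
# THE HORIZONTAL PERIOD ENDGAME AT A GENERAL TIME `t₀ < 0`

Cell ns-regularity-ideate, stub-worker seat ns-poloidal-K2-p2 g17 under the LEAD of item 20428 (ns-poloidal-K2-p3 g17);
`--supports stmt-NavierStokesRegularity-20428 --as helper`.  Port-2 g7's `…HorizontalPeriod` (C2 by vorticity: a horizontal period of `U₂(−1,·)` on the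
slope slab is a period of the whole slice, hence — K2-p2 g15's E2 `…PeriodicSlice` — the profile vanishes) is written on the slice `t = −1`.  In the
assembly A-I of T2B-g17 §7 (case I of `stub_Q4sonicLineNeg`) the PERIODIC branch of the sheet data (S3(e)(f): `U_h∘W_τ` is `2π/ω₀`-periodic in `s` on an
open interval `J` of times, `ω₀` locked by `…FrequencyLock`) ends with a local horizontal period of `U₂(−1+τ,·)` at a time `τ ∈ J` which need NOT be
`0` (the oscillation may be absent at `τ = 0` and present nearby); this file re-types the endgame at a general time `t₀ < 0` — the proofs are port-2's,
with `−1 ↦ t₀` (all tree inputs `analyticOnNhd_slice`, `analyticOnNhd_curl_slice`, `periodic_of_curl_periodic`,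
`…PeriodicSlice.eq_zero_of_periodic_slice_of_class` are time-general; the last one concludes `U ≡ 0` at EVERY `t < 0`, so the hot value `U₂(−1,0) ≠ 0`
of the binders is still the contradiction):

* `curl_translate_eq_on_slab_of_horizontalPeriod_at` / `curl_translate_eq_of_horizontalPeriod_at` — the vorticity slice `curl U(t₀)` inherits a horizontal
  period of `U₂(t₀,·)` on the slope slab (poloidal + slope form at time `t₀`), then on `ℝ³` (analytic slice);
* `translate_slice_eq_of_horizontalPeriod_at` — hence the whole slice `U(t₀)` is `τ`-periodic;
* ★ `false_of_horizontalPeriod_at` / `false_of_local_horizontalPeriod_slab_at` / `false_of_local_horizontalPeriod_shift` — a horizontal period `τ ≠ 0` of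
  `U₂(t₀,·)` on the slab, or on SOME nonempty open set (`horizontalPeriod_two_of_local_at`), together with `U₂(−1,0) ≠ 0` ⇒ `False`; binder currency
  `hslabU : ∀ t, |t+1| < ρ → …` with `|t₀ + 1| < ρ`, resp. `t₀ = −1 + τ₀`, `|τ₀| < ρ`, `|τ₀| < 1/2`.

WHAT THIS IS NOT: not a claim about Navier–Stokes regularity; the time-`t₀` form of an existing Liouville brick for the research cell `stub_Q4sonicLineNeg` of
line twist_split (registry v13); no stub is closed here; items 20428 / 19708 / 27893 OPEN (bears_on LADDER-NS N0).
-/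

set_option linter.style.longLine false
-- the summit and its single sub-problem share the name (CONVENTIONS §1), as in every Theorems file
set_option linter.dupNamespace false

namespace Summit.NavierStokesRegularity.NavierStokesRegularity.Theorems.PoloidalWindowDoorLrcModEntireHorizontalPeriodAtTime

open Set Function Filter Topology Metric
open scoped RealInnerProductSpace InnerProductSpace
open Literature.Analysis Literature.Analysis.FluidPDE
open Summit.NavierStokesRegularity.NavierStokesRegularity.Theorems.LocalSineTubeDoorProfileAlignedWindowRigidityAncient
open Summit.NavierStokesRegularity.NavierStokesRegularity.Theorems.PoloidalWindowDoorPoloidalWindowRigidityOneSlice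
open Summit.NavierStokesRegularity.NavierStokesRegularity.Theorems.PoloidalWindowDoorPoloidalWindowRigidityVorticityTranslate
open Summit.NavierStokesRegularity.NavierStokesRegularity.Theorems.PoloidalWindowDoorPoloidalWindowRigidityLocalVorticitySymmetry
open Summit.NavierStokesRegularity.NavierStokesRegularity.Theorems.PoloidalWindowDoorLrcModEntireThreadPins
open Summit.NavierStokesRegularity.NavierStokesRegularity.Theorems.PoloidalWindowDoorLrcModEntireHorizontalPeriod
open Summit.NavierStokesRegularity.FluidComputer.ColumnarAlignmentZero

variable {C : ℝ} {U : ℝ → EuclideanSpace ℝ (Fin 3) → EuclideanSpace ℝ (Fin 3)}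

/-- **The vorticity inherits a horizontal period of `U₂(t₀,·)` on the slope slab** (time-`t₀` form of
`…HorizontalPeriod.curl_translate_eq_on_slab_of_horizontalPeriod`; port-2 g7's proof with `−1 ↦ t₀`).  Class (for smoothness of the slice), poloidal along
`e₂`, slope form `∂₂U_b(t₀,x) = μ₁(x₂)∂_bU₂(t₀,x)` on `{|x₂| < ρ}`, `τ₂ = 0`, `U₂(t₀, x + τ) = U₂(t₀, x)` for `|x₂| < ρ` ⇒
`curl U(t₀)(y + τ) = curl U(t₀)(y)` for `|y₂| < ρ`. -/
theorem curl_translate_eq_on_slab_of_horizontalPeriod_at (hdec : HasTypeITimeDecay C U) (hcont : ContinuousOn (uncurry U) (Iio (0 : ℝ) ×ˢ univ))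
    (hmild : ∀ s t : ℝ, s < t → t < 0 → ∀ x, U t x = UnboundedOperators.heatExtension (U s) (t - s) x - oseenDuhamel 1 s U U t x)
    (hpol : ∀ s < 0, ∀ q, ⟪curl (U s) q, EuclideanSpace.single 2 1⟫_ℝ = 0)
    {t₀ : ℝ} (ht₀ : t₀ < 0) {ρ : ℝ} {μ₁ : ℝ → ℝ}
    (hslab : ∀ x : EuclideanSpace ℝ (Fin 3), |x 2| < ρ → ∀ b : Fin 3, b ≠ 2 →
      fderiv ℝ (U t₀) x (EuclideanSpace.single 2 1) b = μ₁ (x 2) * fderiv ℝ (U t₀) x (EuclideanSpace.single b 1) 2)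
    {τ : EuclideanSpace ℝ (Fin 3)} (hτ2 : τ 2 = 0)
    (hper : ∀ x : EuclideanSpace ℝ (Fin 3), |x 2| < ρ → U t₀ (x + τ) 2 = U t₀ x 2)
    {y : EuclideanSpace ℝ (Fin 3)} (hy : |y 2| < ρ) : curl (U t₀) (y + τ) = curl (U t₀) y := by
  have han : AnalyticOnNhd ℝ (U t₀) univ := analyticOnNhd_slice hcont (bdd_of_hasTypeITimeDecay hdec) hmild ht₀
  have hdU : Differentiable ℝ (U t₀) := fun x => (han x (mem_univ x)).differentiableAt
  -- the third vorticity component vanishes identically (poloidal)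
  have hω2 : ∀ q, curl (U t₀) q 2 = 0 := fun q => by
    have h := hpol t₀ ht₀ q
    rw [EuclideanSpace.inner_single_right] at h
    simpa using h
  -- componentwise conversion `(DU(t₀)(x) w)₂ = D(U₂(t₀,·))(x) w`
  have hcoord : ∀ x w, fderiv ℝ (U t₀) x w 2 = fderiv ℝ (fun x => U t₀ x 2) x w := fun x w =>
    (fderiv_apply_coord (U t₀) (hdU x) w 2).symm
  -- the period passes to the gradient of `θ = U₂(t₀,·)` on the (open, `τ`-invariant) slab
  have hyτ : (y + τ) 2 = y 2 := by simp [hτ2]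
  have hyτ' : |(y + τ) 2| < ρ := by rw [hyτ]; exact hy
  have hgrad : ∀ w, fderiv ℝ (fun x => U t₀ x 2) (y + τ) w = fderiv ℝ (fun x => U t₀ x 2) y w := fun w => by
    rw [fderiv_translate_eq_of_periodOn (θ := fun x => U t₀ x 2) (isOpen_slab ρ) (τ := τ)
      (show y ∈ {x : EuclideanSpace ℝ (Fin 3) | |x 2| < ρ} from hy) fun x hx => hper x hx]
  ext i
  fin_cases i
  · show curl (U t₀) (y + τ) 0 = curl (U t₀) y 0
    rw [curl_apply_zero, curl_apply_zero, hslab _ hyτ' 1 (by decide), hslab _ hy 1 (by decide), hyτ]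
    simp only [hcoord]
    rw [hgrad]
  · show curl (U t₀) (y + τ) 1 = curl (U t₀) y 1
    rw [curl_apply_one, curl_apply_one, hslab _ hyτ' 0 (by decide), hslab _ hy 0 (by decide), hyτ]
    simp only [hcoord]
    rw [hgrad]
  · show curl (U t₀) (y + τ) 2 = curl (U t₀) y 2
    rw [hω2, hω2]

/-- **… hence on all of `ℝ³`** (the vorticity slice at time `t₀` is real-analytic; identity theorem from the nonempty open slab, `ρ > 0`). -/
theorem curl_translate_eq_of_horizontalPeriod_at (hdec : HasTypeITimeDecay C U) (hcont : ContinuousOn (uncurry U) (Iio (0 : ℝ) ×ˢ univ))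
    (hmild : ∀ s t : ℝ, s < t → t < 0 → ∀ x, U t x = UnboundedOperators.heatExtension (U s) (t - s) x - oseenDuhamel 1 s U U t x)
    (hpol : ∀ s < 0, ∀ q, ⟪curl (U s) q, EuclideanSpace.single 2 1⟫_ℝ = 0)
    {t₀ : ℝ} (ht₀ : t₀ < 0) {ρ : ℝ} (hρ : 0 < ρ) {μ₁ : ℝ → ℝ}
    (hslab : ∀ x : EuclideanSpace ℝ (Fin 3), |x 2| < ρ → ∀ b : Fin 3, b ≠ 2 →
      fderiv ℝ (U t₀) x (EuclideanSpace.single 2 1) b = μ₁ (x 2) * fderiv ℝ (U t₀) x (EuclideanSpace.single b 1) 2)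
    {τ : EuclideanSpace ℝ (Fin 3)} (hτ2 : τ 2 = 0)
    (hper : ∀ x : EuclideanSpace ℝ (Fin 3), |x 2| < ρ → U t₀ (x + τ) 2 = U t₀ x 2) :
    ∀ y : EuclideanSpace ℝ (Fin 3), curl (U t₀) (y + τ) = curl (U t₀) y := by
  have hcan : AnalyticOnNhd ℝ (curl (U t₀)) univ := analyticOnNhd_curl_slice hdec hcont hmild ht₀
  -- the difference `y ↦ curl U(t₀)(y + τ) − curl U(t₀)(y)` is analytic on `ℝ³` and vanishes on the open slab
  have hgan : AnalyticOnNhd ℝ (fun y => curl (U t₀) (y + τ) - curl (U t₀) y) univ := by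
    intro y _
    have hsh : AnalyticAt ℝ (fun y : EuclideanSpace ℝ (Fin 3) => y + τ) y := analyticAt_id.add analyticAt_const
    exact ((hcan (y + τ) (mem_univ _)).comp_of_eq hsh rfl).sub (hcan y (mem_univ _))
  have hev : (fun y => curl (U t₀) (y + τ) - curl (U t₀) y) =ᶠ[𝓝 (0 : EuclideanSpace ℝ (Fin 3))] 0 := by
    filter_upwards [(isOpen_slab ρ).mem_nhds (show (0 : EuclideanSpace ℝ (Fin 3)) ∈ {x : EuclideanSpace ℝ (Fin 3) | |x 2| < ρ} by simpa using hρ)]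
      with y hy
    simp only [Pi.zero_apply, sub_eq_zero]
    exact curl_translate_eq_on_slab_of_horizontalPeriod_at hdec hcont hmild hpol ht₀ hslab hτ2 hper hy
  intro y
  have h := hgan.eqOn_zero_of_preconnected_of_eventuallyEq_zero isPreconnected_univ (mem_univ 0) hev (mem_univ y)
  simpa [sub_eq_zero] using h

/-- ★ **C2 BY VORTICITY AT TIME `t₀`: a horizontal period of `U₂(t₀,·)` on the slope slab is a period of the whole slice `U(t₀)`.**  Class + poloidal + slope
form at time `t₀` on `{|x₂| < ρ}` (`ρ > 0`) + `U₂(t₀, x + τ) = U₂(t₀, x)` for `|x₂| < ρ` (`τ₂ = 0`) ⇒ `U(t₀, x + τ) = U(t₀, x)` for ALL `x`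
(`curl_translate_eq_of_horizontalPeriod_at` + tree `periodic_of_curl_periodic`).  This is the `hslice` input of the periodic Liouville endgame E2 at time `t₀`. -/
theorem translate_slice_eq_of_horizontalPeriod_at (hdec : HasTypeITimeDecay C U) (hcont : ContinuousOn (uncurry U) (Iio (0 : ℝ) ×ˢ univ))
    (hmild : ∀ s t : ℝ, s < t → t < 0 → ∀ x, U t x = UnboundedOperators.heatExtension (U s) (t - s) x - oseenDuhamel 1 s U U t x)
    (hdiv : ∀ t < 0, VectorCalculus.IsDivFree (U t))
    (hpol : ∀ s < 0, ∀ q, ⟪curl (U s) q, EuclideanSpace.single 2 1⟫_ℝ = 0)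
    {t₀ : ℝ} (ht₀ : t₀ < 0) {ρ : ℝ} (hρ : 0 < ρ) {μ₁ : ℝ → ℝ}
    (hslab : ∀ x : EuclideanSpace ℝ (Fin 3), |x 2| < ρ → ∀ b : Fin 3, b ≠ 2 →
      fderiv ℝ (U t₀) x (EuclideanSpace.single 2 1) b = μ₁ (x 2) * fderiv ℝ (U t₀) x (EuclideanSpace.single b 1) 2)
    {τ : EuclideanSpace ℝ (Fin 3)} (hτ2 : τ 2 = 0)
    (hper : ∀ x : EuclideanSpace ℝ (Fin 3), |x 2| < ρ → U t₀ (x + τ) 2 = U t₀ x 2) :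
    ∀ x : EuclideanSpace ℝ (Fin 3), U t₀ (x + τ) = U t₀ x := by
  have hC2 : ContDiff ℝ 2 (U t₀) := (analyticOnNhd_slice hcont (bdd_of_hasTypeITimeDecay hdec) hmild ht₀).contDiff
  exact periodic_of_curl_periodic hC2 (hdiv t₀ ht₀) (fun x => hdec t₀ ht₀ x)
    (curl_translate_eq_of_horizontalPeriod_at hdec hcont hmild hpol ht₀ hρ hslab hτ2 hper)

/-- ★ **A horizontal PERIOD of `U₂(t₀,·)` on the slope slab kills the profile** (time-`t₀` form of `…HorizontalPeriod.false_of_horizontalPeriod`).  Class +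
poloidal + slope form at time `t₀ < 0` on `{|x₂| < ρ}` (`ρ > 0`) + a horizontal period `τ ≠ 0` (`τ₂ = 0`) of `U₂(t₀,·)` on the slab + hot value `U₂(−1,0) ≠ 0`
⇒ `False`: `translate_slice_eq_of_horizontalPeriod_at` makes `τ` a period of the whole slice `U(t₀)`, and K2-p2 g15's E2
`…PeriodicSlice.eq_zero_of_periodic_slice_of_class` (one periodic slice at ANY time `t₀ < 0` ⇒ `U ≡ 0` at every `t < 0`) contradicts the hot value at time `−1`. -/
theorem false_of_horizontalPeriod_at (hdec : HasTypeITimeDecay C U) (hcont : ContinuousOn (uncurry U) (Iio (0 : ℝ) ×ˢ univ))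
    (hmild : ∀ s t : ℝ, s < t → t < 0 → ∀ x, U t x = UnboundedOperators.heatExtension (U s) (t - s) x - oseenDuhamel 1 s U U t x)
    (hdiv : ∀ t < 0, VectorCalculus.IsDivFree (U t))
    (hpol : ∀ s < 0, ∀ q, ⟪curl (U s) q, EuclideanSpace.single 2 1⟫_ℝ = 0) (hne : U (-1) 0 2 ≠ 0)
    {t₀ : ℝ} (ht₀ : t₀ < 0) {ρ : ℝ} (hρ : 0 < ρ) {μ₁ : ℝ → ℝ}
    (hslab : ∀ x : EuclideanSpace ℝ (Fin 3), |x 2| < ρ → ∀ b : Fin 3, b ≠ 2 →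
      fderiv ℝ (U t₀) x (EuclideanSpace.single 2 1) b = μ₁ (x 2) * fderiv ℝ (U t₀) x (EuclideanSpace.single b 1) 2)
    {τ : EuclideanSpace ℝ (Fin 3)} (hτ2 : τ 2 = 0) (hτ : τ ≠ 0)
    (hper : ∀ x : EuclideanSpace ℝ (Fin 3), |x 2| < ρ → U t₀ (x + τ) 2 = U t₀ x 2) : False := by
  have hzero := PoloidalWindowDoorLrcModEntirePeriodicSlice.eq_zero_of_periodic_slice_of_class hdec hcont hmild hdiv hτ ht₀
    (translate_slice_eq_of_horizontalPeriod_at hdec hcont hmild hdiv hpol ht₀ hρ hslab hτ2 hper)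
  apply hne
  rw [hzero (-1) (by norm_num) 0]
  rfl

/-- **Binder currency** of `false_of_horizontalPeriod_at` (registered U-package: slab slope form `∀ t, |t + 1| < ρ → …`, `μ : ℝ → ℝ → ℝ`; a time `t₀ < 0` with
`|t₀ + 1| < ρ`). -/
theorem false_of_horizontalPeriod_slab_at (hdec : HasTypeITimeDecay C U) (hcont : ContinuousOn (uncurry U) (Iio (0 : ℝ) ×ˢ univ))
    (hmild : ∀ s t : ℝ, s < t → t < 0 → ∀ x, U t x = UnboundedOperators.heatExtension (U s) (t - s) x - oseenDuhamel 1 s U U t x)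
    (hdiv : ∀ t < 0, VectorCalculus.IsDivFree (U t))
    (hpol : ∀ s < 0, ∀ q, ⟪curl (U s) q, EuclideanSpace.single 2 1⟫_ℝ = 0) (hne : U (-1) 0 2 ≠ 0)
    {t₀ : ℝ} (ht₀ : t₀ < 0) {ρ : ℝ} (hρ : 0 < ρ) (ht₀ρ : |t₀ + 1| < ρ) {μ : ℝ → ℝ → ℝ}
    (hslabU : ∀ t : ℝ, |t + 1| < ρ → ∀ x : EuclideanSpace ℝ (Fin 3), |x 2| < ρ → ∀ b : Fin 3, b ≠ 2 →
      fderiv ℝ (U t) x (EuclideanSpace.single 2 1) b = μ t (x 2) * fderiv ℝ (U t) x (EuclideanSpace.single b 1) 2)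
    {τ : EuclideanSpace ℝ (Fin 3)} (hτ2 : τ 2 = 0) (hτ : τ ≠ 0)
    (hper : ∀ x : EuclideanSpace ℝ (Fin 3), |x 2| < ρ → U t₀ (x + τ) 2 = U t₀ x 2) : False :=
  false_of_horizontalPeriod_at hdec hcont hmild hdiv hpol hne ht₀ hρ (μ₁ := μ t₀)
    (fun x hx b hb => hslabU t₀ ht₀ρ x hx b hb) hτ2 hτ hper


/-! ### Local currency at time `t₀`: a period on SOME nonempty open set suffices (the slice is real-analytic) -/

/-- **A local period spreads (time `t₀`):** if `U₂(t₀, x + τ) = U₂(t₀, x)` for `x` in a nonempty open set `V`, then for ALL `x ∈ ℝ³` (identity theorem for the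
real-analytic function `x ↦ U₂(t₀, x + τ) − U₂(t₀, x)`).  This is the bridge from what the mixed-system Cauchy–Kovalevskaya uniqueness of T2B-g17 §7 S4/S5 delivers
(a neighbourhood of ONE sheet point at a time `t₀ = −1+τ`) to the slab hypothesis `hper`. -/
theorem horizontalPeriod_two_of_local_at (hdec : HasTypeITimeDecay C U) (hcont : ContinuousOn (uncurry U) (Iio (0 : ℝ) ×ˢ univ))
    (hmild : ∀ s t : ℝ, s < t → t < 0 → ∀ x, U t x = UnboundedOperators.heatExtension (U s) (t - s) x - oseenDuhamel 1 s U U t x)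
    {t₀ : ℝ} (ht₀ : t₀ < 0)
    {τ : EuclideanSpace ℝ (Fin 3)} {V : Set (EuclideanSpace ℝ (Fin 3))} (hV : IsOpen V) (hVne : V.Nonempty)
    (hper : ∀ x ∈ V, U t₀ (x + τ) 2 = U t₀ x 2) : ∀ x : EuclideanSpace ℝ (Fin 3), U t₀ (x + τ) 2 = U t₀ x 2 := by
  have han : AnalyticOnNhd ℝ (U t₀) univ := analyticOnNhd_slice hcont (bdd_of_hasTypeITimeDecay hdec) hmild ht₀
  have hθan : AnalyticOnNhd ℝ (fun x => U t₀ x 2) univ := fun x _ =>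
    ((EuclideanSpace.proj (𝕜 := ℝ) (2 : Fin 3)).analyticAt _).comp (han x (mem_univ x))
  have hgan : AnalyticOnNhd ℝ (fun x => U t₀ (x + τ) 2 - U t₀ x 2) univ := by
    intro x _
    have hsh : AnalyticAt ℝ (fun y : EuclideanSpace ℝ (Fin 3) => y + τ) x := analyticAt_id.add analyticAt_const
    exact ((hθan (x + τ) (mem_univ _)).comp_of_eq hsh rfl).sub (hθan x (mem_univ _))
  obtain ⟨x₀, hx₀⟩ := hVne
  have hev : (fun x => U t₀ (x + τ) 2 - U t₀ x 2) =ᶠ[𝓝 x₀] 0 := by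
    filter_upwards [hV.mem_nhds hx₀] with x hx
    simp only [Pi.zero_apply, sub_eq_zero]
    exact hper x hx
  intro x
  have h := hgan.eqOn_zero_of_preconnected_of_eventuallyEq_zero isPreconnected_univ (mem_univ x₀) hev (mem_univ x)
  simpa [sub_eq_zero] using h

/-- ★ **The periodic endgame from a LOCAL period at time `t₀`** (binder currency): registered slab slope form (`∀ t, |t + 1| < ρ → …`, `0 < ρ`), class, poloidal,
a time `t₀ < 0` with `|t₀ + 1| < ρ`, a horizontal `τ ≠ 0` that is a period of `U₂(t₀,·)` on SOME nonempty open set, hot value `U₂(−1,0) ≠ 0` ⇒ `False`. -/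
theorem false_of_local_horizontalPeriod_slab_at (hdec : HasTypeITimeDecay C U) (hcont : ContinuousOn (uncurry U) (Iio (0 : ℝ) ×ˢ univ))
    (hmild : ∀ s t : ℝ, s < t → t < 0 → ∀ x, U t x = UnboundedOperators.heatExtension (U s) (t - s) x - oseenDuhamel 1 s U U t x)
    (hdiv : ∀ t < 0, VectorCalculus.IsDivFree (U t))
    (hpol : ∀ s < 0, ∀ q, ⟪curl (U s) q, EuclideanSpace.single 2 1⟫_ℝ = 0) (hne : U (-1) 0 2 ≠ 0)
    {t₀ : ℝ} (ht₀ : t₀ < 0) {ρ : ℝ} (hρ : 0 < ρ) (ht₀ρ : |t₀ + 1| < ρ) {μ : ℝ → ℝ → ℝ}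
    (hslabU : ∀ t : ℝ, |t + 1| < ρ → ∀ x : EuclideanSpace ℝ (Fin 3), |x 2| < ρ → ∀ b : Fin 3, b ≠ 2 →
      fderiv ℝ (U t) x (EuclideanSpace.single 2 1) b = μ t (x 2) * fderiv ℝ (U t) x (EuclideanSpace.single b 1) 2)
    {τ : EuclideanSpace ℝ (Fin 3)} (hτ2 : τ 2 = 0) (hτ : τ ≠ 0)
    {V : Set (EuclideanSpace ℝ (Fin 3))} (hV : IsOpen V) (hVne : V.Nonempty)
    (hper : ∀ x ∈ V, U t₀ (x + τ) 2 = U t₀ x 2) : False :=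
  false_of_horizontalPeriod_slab_at hdec hcont hmild hdiv hpol hne ht₀ hρ ht₀ρ hslabU hτ2 hτ
    fun x _ => horizontalPeriod_two_of_local_at hdec hcont hmild ht₀ hV hVne hper x

/-- **The same with the time written as `−1 + τ₀`, `|τ₀| < ρ`, `|τ₀| < 1/2`** (the currency of the space–time web package `…Q4TimeWebPackage`: times `−1+τ`). -/
theorem false_of_local_horizontalPeriod_shift (hdec : HasTypeITimeDecay C U) (hcont : ContinuousOn (uncurry U) (Iio (0 : ℝ) ×ˢ univ))
    (hmild : ∀ s t : ℝ, s < t → t < 0 → ∀ x, U t x = UnboundedOperators.heatExtension (U s) (t - s) x - oseenDuhamel 1 s U U t x)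
    (hdiv : ∀ t < 0, VectorCalculus.IsDivFree (U t))
    (hpol : ∀ s < 0, ∀ q, ⟪curl (U s) q, EuclideanSpace.single 2 1⟫_ℝ = 0) (hne : U (-1) 0 2 ≠ 0)
    {ρ : ℝ} (hρ : 0 < ρ) {μ : ℝ → ℝ → ℝ}
    (hslabU : ∀ t : ℝ, |t + 1| < ρ → ∀ x : EuclideanSpace ℝ (Fin 3), |x 2| < ρ → ∀ b : Fin 3, b ≠ 2 →
      fderiv ℝ (U t) x (EuclideanSpace.single 2 1) b = μ t (x 2) * fderiv ℝ (U t) x (EuclideanSpace.single b 1) 2)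
    {τ₀ : ℝ} (hτ₀ρ : |τ₀| < ρ) (hτ₀h : |τ₀| < 1 / 2)
    {τ : EuclideanSpace ℝ (Fin 3)} (hτ2 : τ 2 = 0) (hτ : τ ≠ 0)
    {V : Set (EuclideanSpace ℝ (Fin 3))} (hV : IsOpen V) (hVne : V.Nonempty)
    (hper : ∀ x ∈ V, U (-1 + τ₀) (x + τ) 2 = U (-1 + τ₀) x 2) : False :=
  false_of_local_horizontalPeriod_slab_at hdec hcont hmild hdiv hpol hne (t₀ := -1 + τ₀) (by linarith [(abs_lt.1 hτ₀h).2]) hρ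
    (by simpa using hτ₀ρ) hslabU hτ2 hτ hV hVne hper

end Summit.NavierStokesRegularity.NavierStokesRegularity.Theorems.PoloidalWindowDoorLrcModEntireHorizontalPeriodAtTime
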